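import Literature.AnabelianGeometry.AbsoluteAnabelian.MonoidKummerTransport
import Literature.AnabelianGeometry.AbsoluteAnabelian.MLFGaloisPairsWitness
import Mathlib.FieldTheory.RatFunc.Degree
import Mathlib.FieldTheory.RatFunc.AsPolynomial

/-!
# [AbsTopIII] Prop 3.2 (v), object level: `RecoversClosure` is a genuine constraint on the datum of (iii)
# (kernel status of FACT-LIST row F-0173)

S. Mochizuki, *Topics in absolute anabelian geometry III*, §3, Prop. 3.2 (iii)/(v) p. 72 (bib key
`MochizukiAbsTopIII2015`; kurims manuscript `paper:url-5493eb38cbb7`, read on the cell's render p. 72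
l. 6–13 / l. 29–42): (iii) "the construction of Corollary 1.10, (h), determines an additive structure [hence,
in particular, a topological field structure] on the union with `{0}` of the group generated by the image of
the Kummer map"; (v) "the functor `𝔩𝔬𝔤_{T,T}` is isomorphic to the identity functor" — typed at the level of
objects by abc-iut-L4-t2 as the PREDICATE `MonoidKummerTheory.RecoversClosure C T j` (`MonoidKummerMaps.lean`,
p410207): the field `T.F` of (iii) is `k̄` with `M ↦ 𝒪_k̄^⊳ ⊆ k̄` along `j`.

What the tree already proves (cited BY NAME, nothing restated): the predicate HOLDS for the model Kummer
theory of every model pair (`ModelMLFGaloisData.kummerTheory_recoversClosure`, p409840) and, by transport,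
SOME Kummer theory of every MLF-Galois `TM`-pair recovers the closure
(`exists_monoidKummerTheory_recoversClosure`, p421728; Kummer-faithful form p422225).

What this PROOF-ONLY file (no `def`) adds (cone row AbsTopIII:Prop3.2(v), FACT-LIST row F-0173, whose status was
"model-witness … not a proof of the closure"): the universal closure of the predicate is FALSE, and sharply
so — not merely for a silly `j`, but ON THE MODEL PAIR `(Π_k ↷ 𝒪_k̄^⊳)` WITH THE CANONICAL INCLUSION
`j : 𝒪_k̄^⊳ ⊆ k̄`: keeping the cohomology, the cyclotomic identification and the Kummer maps of a Kummer
theory `T` (the data of Prop. 3.2 (i), (ii), Rmk. 3.2.1) and replacing ONLY the field of (iii) by the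
rational function field `T.F(X)` (with `M ↪ T.F ↪ T.F(X)`) gives another `MonoidKummerTheory` on the same
pair which recovers NO algebraic closure through ANY `j` (`MonoidKummerTheory.exists_not_recoversClosure`:
`F(X)` is never algebraically closed — `X` is not a square, by the `ℤ`-valued degree — while `k̄` is).  Consequences: `exists_not_recoversClosure_of_isMLFGaloisMonoidPair` (every MLF-Galois `TM`-pair carries
a Kummer theory that does not recover the closure), `exists_model_not_recoversClosure` (at the
concrete model pair over `ℚ₂` of `MLFGaloisPairsWitness`, canonical `j`), `not_forall_recoversClosure`
(F-0173: universal closure REFUTED; instance form PROVED p409840 / p421728).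

READING (honest scope, for the node ledger): the (i)(ii)-fields of a Kummer theory do NOT determine the
additive structure of (iii); `RecoversClosure` is exactly the extra content that print obtains from "the
construction of Corollary 1.10, (h)" (Belyi cuspidalization; FACT-policy input of campaign M, sub-DAG row
P32.iii.L12) — the object-level shadow of the functor-level residual `nonempty_prop32iiiAlgorithm_iff_full`
(abc-iut-L4-t9, `MLFGaloisLogFrobeniusFactorization.lean`).  OUR kernel theorems about OUR typing; refereed
pre-IUT material; nothing here bears on [IUTchIII] Cor. 3.12 or takes a side; typed ≠ proved downstream.
-/

noncomputable section

universe u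

namespace Literature.AnabelianGeometry.AbsoluteAnabelian

/-! ### A rational function field is not algebraically closed -/

/-- In a rational function field `F(X)` the variable `X` is not a square (compare `ℤ`-valued degrees:
`2 · deg y = 1` is impossible). [folklore] -/
private theorem ratFunc_X_ne_mul_self (F : Type u) [Field F] (y : RatFunc F) : y * y ≠ RatFunc.X := by
  intro h
  by_cases hy : y = 0
  · rw [hy, zero_mul] at h
    exact RatFunc.X_ne_zero h.symm
  · have hdeg := congrArg RatFunc.intDegree h
    rw [RatFunc.intDegree_mul hy hy, RatFunc.intDegree_X] at hdeg
    omega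

/-- A rational function field `F(X)` admits no ring isomorphism onto an algebraically closed field (the
image of `X` would have a square root). [folklore] -/
private theorem isEmpty_ratFunc_ringEquiv_of_isAlgClosed (F : Type u) [Field F] (K : Type u) [Field K]
    [IsAlgClosed K] : IsEmpty (RatFunc F ≃+* K) := by
  refine ⟨fun e => ?_⟩
  obtain ⟨z, hz⟩ := IsAlgClosed.exists_pow_nat_eq (e RatFunc.X) (n := 2) two_pos
  apply ratFunc_X_ne_mul_self F (e.symm z)
  rw [← map_mul, ← pow_two, hz, RingEquiv.symm_apply_apply]

namespace MonoidKummerTheory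

variable {Q : GaloisMonoidPair.{u}}

/-! ### Changing only the field of (iii): `RecoversClosure` fails through every `j` -/

/-- **Same (i)(ii)-data, another (iii)-datum, recovering NO algebraic closure.**  From a Kummer theory `T`
on `(Π ↷ M)` keep the continuous cohomology, `H² ⥲ Ẑ`, `μ_Ẑ(M) ⥲ μ_Ẑ(G)` and the Kummer maps (the data of
Prop. 3.2 (i), (ii), Rmk. 3.2.1 — the conjuncts `T'.coh = T.coh`, `T'.kummer ≍ T.kummer`,
`T'.kummerLim ≍ T.kummerLim`) and replace the field `F` of Prop. 3.2 (iii) by the rational function field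
`F(X)`, receiving `M` through `M ↪ F ↪ F(X)` (still injective, still non-zero): the resulting Kummer theory
`T'` satisfies `¬ T'.RecoversClosure C j` for EVERY MLF-closure datum `(k, k̄)` and EVERY `j : M → k̄` (in
particular the canonical inclusion `𝒪_k̄^⊳ ⊆ k̄` of a model pair) — `F(X)` is not isomorphic to the
algebraically closed `k̄`.  So the (i)(ii)-fields do not determine the additive structure of (iii).
[cite: MochizukiAbsTopIII2015, Proposition 3.2 (v) p.72] -/
theorem exists_not_recoversClosure (T : MonoidKummerTheory Q) :
    ∃ T' : MonoidKummerTheory Q, T'.coh = T.coh ∧ HEq T'.kummer T.kummer ∧ HEq T'.kummerLim T.kummerLim ∧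
      ∀ (C : MLFClosure.{u}) (j : Q.M → C.K), ¬ T'.RecoversClosure C j := by
  refine ⟨{ coh := T.coh
            h2Iso := T.h2Iso
            muG := T.muG
            cycIso := T.cycIso
            kummer := T.kummer
            kummer_mul := T.kummer_mul
            kummer_res := T.kummer_res
            kummerLim := T.kummerLim
            kummerLim_spec := T.kummerLim_spec
            F := RatFunc T.F
            addStr := (RatFunc.C : T.F →+* RatFunc T.F).toMonoidHom.comp T.addStr
            addStr_injective := RatFunc.C_injective.comp T.addStr_injective
            addStr_ne_zero := fun m =>
              (map_ne_zero_iff _ RatFunc.C_injective).mpr (T.addStr_ne_zero m) },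
    rfl, HEq.rfl, HEq.rfl, fun C j => ?_⟩
  rintro ⟨e, -, -⟩
  haveI : IsAlgClosed C.K := IsAlgClosure.isAlgClosed C.k
  exact (isEmpty_ratFunc_ringEquiv_of_isAlgClosed T.F C.K).false e

/-- **For every MLF-Galois `TM`-pair** there is a Kummer theory on it (with the cohomology and Kummer maps of
one that DOES recover the closure, `exists_monoidKummerTheory_recoversClosure` p421728) that recovers the
closure through no `j`. [cite: MochizukiAbsTopIII2015, Proposition 3.2 (v) p.72] -/
theorem exists_not_recoversClosure_of_isMLFGaloisMonoidPair (P : GaloisMonoidPair.{0})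
    (hP : IsMLFGaloisMonoidPair .TM P) :
    ∃ T : MonoidKummerTheory P, ∀ (C : MLFClosure.{0}) (j : P.M → C.K), ¬ T.RecoversClosure C j := by
  obtain ⟨T⟩ := nonempty_monoidKummerTheory P hP
  obtain ⟨T', -, -, -, hT'⟩ := T.exists_not_recoversClosure
  exact ⟨T', hT'⟩

end MonoidKummerTheory

/-! ### At the model pair, with the canonical inclusion; the universal closure of F-0173 -/

/-- **At every model pair `(Π_k ↷ 𝒪_k̄^⊳)`, with the CANONICAL inclusion `j : 𝒪_k̄^⊳ ⊆ k̄`**, some Kummer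
theory — sharing cohomology and Kummer maps with the model Kummer theory of p409840 — does not recover the
closure. [cite: MochizukiAbsTopIII2015, Proposition 3.2 (v) p.72] -/
theorem ModelMLFGaloisData.exists_kummerTheory_not_recoversClosure (C : MLFClosure.{0})
    (D : ModelMLFGaloisData C.k C.K) :
    ∃ T : MonoidKummerTheory D.tmPair, T.coh = (D.kummerTheory C).coh ∧
      HEq T.kummer (D.kummerTheory C).kummer ∧ HEq T.kummerLim (D.kummerTheory C).kummerLim ∧
      ¬ T.RecoversClosure C (fun m : D.tmPair.M => (m : C.K)) := by
  obtain ⟨T, h₁, h₂, h₃, hT⟩ := (D.kummerTheory C).exists_not_recoversClosure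
  exact ⟨T, h₁, h₂, h₃, hT C _⟩

/-- **Concretely** (the model pair `(G_k × ℤ ↷ 𝒪_k̄^⊳)` over `k = ℚ₂` of `MLFGaloisPairsWitness`): a Kummer
theory on an honest MLF-Galois `TM`-pair, canonical `j`, NOT recovering the closure.
[cite: MochizukiAbsTopIII2015, Proposition 3.2 (v) p.72] -/
theorem exists_model_not_recoversClosure :
    ∃ (C : MLFClosure.{0}) (D : ModelMLFGaloisData C.k C.K) (T : MonoidKummerTheory D.tmPair),
      IsMLFGaloisMonoidPair .TM D.tmPair ∧ ¬ T.RecoversClosure C (fun m : D.tmPair.M => (m : C.K)) := by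
  obtain ⟨T, -, -, -, hT⟩ :=
    AutPairCenterFreeWitness.D.exists_kummerTheory_not_recoversClosure AutPairCenterFreeWitness.C
  exact ⟨AutPairCenterFreeWitness.C, AutPairCenterFreeWitness.D, T,
    AutPairCenterFreeWitness.isMLFGaloisMonoidPair_P, hT⟩

/-- **FACT-LIST row F-0173, kernel status: the universal closure of `MonoidKummerTheory.RecoversClosure` is
REFUTED** (instance form PROVED: `ModelMLFGaloisData.kummerTheory_recoversClosure` p409840,
`exists_monoidKummerTheory_recoversClosure` p421728).  `RecoversClosure` is a property of the (iii)-datum,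
not a consequence of the (i)(ii)-data. [cite: MochizukiAbsTopIII2015, Proposition 3.2 (v) p.72] -/
theorem not_forall_recoversClosure :
    ¬ ∀ (C : MLFClosure.{0}) (Q : GaloisMonoidPair.{0}) (T : MonoidKummerTheory Q) (j : Q.M → C.K),
      T.RecoversClosure C j := by
  intro h
  obtain ⟨C, D, T, -, hT⟩ := exists_model_not_recoversClosure
  exact hT (h C D.tmPair T _)

end Literature.AnabelianGeometry.AbsoluteAnabelian

end
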